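import Mathlib.Analysis.SpecialFunctions.Complex.LogBounds
import Mathlib.Analysis.SpecialFunctions.Complex.Arg
import Mathlib.Analysis.SpecialFunctions.Trigonometric.ArctanDeriv
import Mathlib.Analysis.Calculus.Deriv.MeanValue
import Mathlib.MeasureTheory.Integral.IntervalIntegral.FundThmCalculus
import Mathlib.Analysis.SpecialFunctions.ExpDeriv
import Mathlib.Analysis.SpecialFunctions.Pow.Real
import Mathlib.Analysis.Complex.RealDeriv
import Mathlib.Analysis.Real.Pi.Bounds
import HarnessLib

/-!
# Gabcke's function `g̃(a, x − a)` on the saddle-point line of the Riemann–Siegel integral, and its elementary bounds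

Topic `Literature/NumberTheory/LFunctions`. In Siegel's integral representation of `Z(t)` the numerator
`x^{−s} e^{πix²}` (`s = ½ + it`, `t = 2πa²`) is written on the line of steepest descent through the saddle point
`x = a = √(t/2π)`, `x = a + u(1+i)`, as (Gabcke 1979, Kap. 1, eq. (1.8), in the complex-conjugate normalisation of
the tree's `Literature/NumberTheory/LFunctions/RiemannSiegelAuxiliary.lean`)

  `x^{−s} e^{πix²} = a^{−s} e^{πia²} · e^{−4πu²} · g̃(a, u)`,  `g̃(a, u) = exp E(a, u)`,
  `E(a, u) = 2πia² (w − w²/2 − log(1+w)) − ½ log(1+w)`,  `w = (1+i)u/a`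

(`Literature.NumberTheory.LFunctions.Gabcke.gExp`, `Literature.NumberTheory.LFunctions.Gabcke.gTilde`; the exponent
collects Gabcke's `(−½ ∓ it) log(1 + z/a) ∓ 2πiaz ± iπz²`, eq. (1.8), with `e^{−4πu²} = e^{2πia²w²}` taken out).
This file is the ESTIMATES half of an explicit bound for the remainder `R₀(t)` of the Riemann–Siegel formula with
the single correction term `C₀` (Gabcke's Satz 3.1.2 specialised to `K = 0`, in a cruder but elementary form —
our route: no differential equation, no power series in `τ`): everything is real analysis of the explicit
function `E`.

* `gExp_eq_add_add`: `E = E₁ + E₂ + E₃` with `E₁ = ((1+i)/a)(4πu³/3 − u/2)` (first order in `1/a`),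
  `E₂ = (i/a²)(u²/2 − 2πu⁴)` (second order) and `E₃ = −2πia² L₄(w) − ½ L₂(w)`, `L_k` the Taylor remainders of
  `log(1+w)`; `norm_gExp_le`: for `|u| ≤ a/2`,
  `‖E‖ ≤ (√2/a)|4πu³/3 − u/2| + (u²/2 + 2πu⁴)/a² + (2+√2)(√2/a³)(8π|u|⁵/5 + |u|³/3)`
  (Mathlib's `Complex.norm_log_sub_logTaylor_le`);
* `gExp_re`: `Re E = 2πa²(arg(1+w) − y + y²) − ¼ log(1 + 2y + 2y²)`, `y = u/a`, and the three arc-tangent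
  inequalities `arctan(y/(1+y)) ≤ y − y² + ⅔y³` (`y ≥ 0`), `≤ y − y²` (`−½ ≤ y ≤ 0`), `arg ≤ y + y²/2` (all `y`),
  each by the sign of a derivative;
* consequences: `gExp_re_le_of_nonneg` (`Re E ≤ (4π/3)u³/a` for `u ≥ 0`), `exp_gExp_re_le_of_nonpos`
  (`e^{Re E} ≤ 1 + |u|/a` for `−a/2 ≤ u ≤ 0`), `gExp_re_le_far` (`−4πu² + Re E ≤ −πu² + (log 2)/4`, all `u`);
* `norm_cexp_sub_one_le`: `‖e^E − 1‖ ≤ ‖E‖ · max(1, e^{Re E})` (fundamental theorem of calculus on `s ↦ e^{sE}`);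
* the pointwise majorants used by the integration: `norm_gTilde_sub_one_le_of_nonneg`,
  `norm_gTilde_sub_one_le_of_nonpos` (`|u| ≤ a/2`) and `norm_gTilde_sub_one_le_far` (all `u`).

No facts, no axioms beyond the standard three. What is NOT here: the identity with `x^{−s} e^{πix²}` (it needs the
complex power; `RiemannSiegelSaddleRepresentation.lean`), the integrals (`RiemannSiegelRemainderK0.lean`), and
Gabcke's sharper four-regime bounds (Satz 3.1.2) or anything for `K ≥ 1`.

## References

* W. Gabcke, *Neue Herleitung und explizite Restabschätzung der Riemann-Siegel-Formel*, Dissertation,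
  Göttingen 1979: Kap. 1 eq. (1.8) p. 10 (the function `g̃`), Satz 1.2.1 p. 12 (`g(τ, z)`), §3.1 Satz 3.1.2 pp.
  44–47 (pointwise bounds for `g − 1` on the bisector). [Gabcke1979]
-/

noncomputable section

open Complex Real Set MeasureTheory intervalIntegral

namespace Literature.NumberTheory.LFunctions

namespace Gabcke

/-! ## The function `E(a, u)` and `g̃ = e^E` -/

/-- `w = (1+i)u/a`, the relative displacement `(x − a)/a` on the saddle-point line `x = a + u(1+i)`.
[cite: Gabcke1979, Kap. 1 eq. (1.8)] -/
def gW (a u : ℝ) : ℂ := (u : ℂ) * (1 + I) / a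

/-- Gabcke's exponent: `E(a, u) = 2πia²(w − w²/2 − log(1+w)) − ½ log(1+w)`, `w = (1+i)u/a`, so that
`x^{−s}e^{πix²} = a^{−s}e^{πia²} e^{−4πu²} e^{E}` at `x = a + u(1+i)`, `s = ½ + 2πia²·i`-free form of eq. (1.8)
(conjugate normalisation). [cite: Gabcke1979, Kap. 1 eq. (1.8)] -/
def gExp (a u : ℝ) : ℂ :=
  2 * π * I * (a : ℂ) ^ 2 * (gW a u - gW a u ^ 2 / 2 - Complex.log (1 + gW a u)) - Complex.log (1 + gW a u) / 2

/-- Gabcke's `g̃(a, x − a) = e^{E(a,u)}` on the saddle-point line (`g̃(a, 0) = 1`). [cite: Gabcke1979, Kap. 1 eq. (1.8)] -/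
def gTilde (a u : ℝ) : ℂ := cexp (gExp a u)

/-- The first-order part `E₁ = ((1+i)/a)(4πu³/3 − u/2)` of `E` (it produces Gabcke's `C₁` term).
[cite: Gabcke1979, Kap. 1 eq. (1.8)] -/
def gE1 (a u : ℝ) : ℂ := (1 + I) / a * ((4 * π * u ^ 3 / 3 - u / 2 : ℝ) : ℂ)

/-- The second-order part `E₂ = (i/a²)(u²/2 − 2πu⁴)` of `E`. [cite: Gabcke1979, Kap. 1 eq. (1.8)] -/
def gE2 (a u : ℝ) : ℂ := I / (a : ℂ) ^ 2 * ((u ^ 2 / 2 - 2 * π * u ^ 4 : ℝ) : ℂ)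

variable {a u : ℝ}

/-- `1 + w = (1 + u/a) + (u/a) i`: real part. [folklore] -/
private lemma one_add_gW_re (ha : a ≠ 0) : (1 + gW a u).re = 1 + u / a := by
  simp [gW, Complex.div_re, Complex.normSq_ofReal]; field_simp

/-- `1 + w = (1 + u/a) + (u/a) i`: imaginary part. [folklore] -/
private lemma one_add_gW_im (ha : a ≠ 0) : (1 + gW a u).im = u / a := by
  simp [gW, Complex.div_im, Complex.normSq_ofReal]; field_simp

/-- `1 + w` as a complex number with explicit real and imaginary parts. [folklore] -/
private lemma one_add_gW_eq (ha : a ≠ 0) : 1 + gW a u = ((1 + u / a : ℝ) : ℂ) + ((u / a : ℝ) : ℂ) * I :=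
  Complex.ext (by simp [one_add_gW_re ha]) (by simp [one_add_gW_im ha])

/-- `‖w‖ = √2 |u| / a` for `a > 0` (`|z|/a` on the bisector, Gabcke's `2τ|z| < 1` domain). [cite: Gabcke1979, Kap. 1 eq. (1.8)] -/
lemma norm_gW (ha : 0 < a) : ‖gW a u‖ = Real.sqrt 2 * |u| / a := by
  rw [gW, norm_div, norm_mul, Complex.norm_real, Complex.norm_real, Real.norm_eq_abs, Real.norm_eq_abs,
    abs_of_pos ha]
  have : ‖(1 : ℂ) + I‖ = Real.sqrt 2 := by
    rw [Complex.norm_eq_sqrt_sq_add_sq]; norm_num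
  rw [this]; ring

/-- `‖1 + w‖² = 1 + 2y + 2y²`, `y = u/a` (so `1 + w` stays off the cut: Gabcke's remark after (1.8) that `g̃` is
single-valued holomorphic in the slit plane). [cite: Gabcke1979, Kap. 1 eq. (1.8)] -/
lemma normSq_one_add_gW (ha : a ≠ 0) : ‖1 + gW a u‖ ^ 2 = 1 + 2 * (u / a) + 2 * (u / a) ^ 2 := by
  rw [one_add_gW_eq ha, Complex.sq_norm, Complex.normSq_add_mul_I]; ring

/-- `1 + w ≠ 0` (its norm square is `≥ 1/2`; Gabcke's remark after (1.8)). [cite: Gabcke1979, Kap. 1 eq. (1.8)] -/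
lemma one_add_gW_ne_zero (ha : a ≠ 0) : 1 + gW a u ≠ 0 := by
  intro h
  have h1 := normSq_one_add_gW (u := u) ha
  rw [h, norm_zero] at h1
  nlinarith [sq_nonneg (u / a + 1 / 2)]

/-! ## The decomposition `E = E₁ + E₂ + E₃` and the bound for `‖E‖` -/

/-- `logTaylor 3 z = z − z²/2`. [folklore] -/
private lemma logTaylor_three (z : ℂ) : logTaylor 3 z = z - z ^ 2 / 2 := by
  simp [logTaylor_succ, logTaylor_zero]; ring

/-- `logTaylor 5 z = z − z²/2 + z³/3 − z⁴/4`. [folklore] -/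
private lemma logTaylor_five (z : ℂ) : logTaylor 5 z = z - z ^ 2 / 2 + z ^ 3 / 3 - z ^ 4 / 4 := by
  simp [logTaylor_succ, logTaylor_zero]; ring

/-- Powers of `w = (1+i)u/a`: `w² = 2iu²/a²`. [folklore] -/
private lemma gW_sq (ha : a ≠ 0) : gW a u ^ 2 = 2 * I * (u : ℂ) ^ 2 / (a : ℂ) ^ 2 := by
  have ha' : (a : ℂ) ≠ 0 := Complex.ofReal_ne_zero.2 ha
  simp only [gW]; field_simp; ring_nf; rw [Complex.I_sq]; ring

/-- **The decomposition of Gabcke's exponent**: `E = E₁ + E₂ + (−2πia² L₄(w) − ½ L₂(w))` with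
`L₂(w) = log(1+w) − (w − w²/2)`, `L₄(w) = log(1+w) − (w − w²/2 + w³/3 − w⁴/4)`. [cite: Gabcke1979, Kap. 1 eq. (1.8)] -/
theorem gExp_eq_add_add (ha : a ≠ 0) :
    gExp a u = gE1 a u + gE2 a u
      + (-(2 * π * I * (a : ℂ) ^ 2) * (Complex.log (1 + gW a u) - logTaylor 5 (gW a u))
          - (Complex.log (1 + gW a u) - logTaylor 3 (gW a u)) / 2) := by
  have ha' : (a : ℂ) ≠ 0 := Complex.ofReal_ne_zero.2 ha
  rw [logTaylor_three, logTaylor_five]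
  -- the logarithm cancels; what remains is a polynomial identity in `w = (1+i)u/a`
  have key : gExp a u - (gE1 a u + gE2 a u
      + (-(2 * π * I * (a : ℂ) ^ 2) * (Complex.log (1 + gW a u) - (gW a u - gW a u ^ 2 / 2 + gW a u ^ 3 / 3
          - gW a u ^ 4 / 4)) - (Complex.log (1 + gW a u) - (gW a u - gW a u ^ 2 / 2)) / 2))
      = -(gE1 a u) - gE2 a u - 2 * π * I * (a : ℂ) ^ 2 * (gW a u ^ 3 / 3 - gW a u ^ 4 / 4)
          - (gW a u - gW a u ^ 2 / 2) / 2 := by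
    simp only [gExp]; ring
  rw [← sub_eq_zero, key]
  have hI3 : (I : ℂ) ^ 3 = -I := by rw [pow_succ, Complex.I_sq]; ring
  have hI4 : (I : ℂ) ^ 4 = 1 := by rw [show (4 : ℕ) = 2 * 2 from rfl, pow_mul, Complex.I_sq]; norm_num
  simp only [gE1, gE2, gW]
  push_cast
  field_simp
  have hI5 : (I : ℂ) ^ 5 = I := by rw [pow_succ, hI4, one_mul]
  ring_nf
  simp only [hI3, hI4, hI5, Complex.I_sq]
  ring

/-- `‖E₁‖ = (√2/a)|4πu³/3 − u/2|` for `a > 0`. [cite: Gabcke1979, Kap. 1 eq. (1.8)] -/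
lemma norm_gE1 (ha : 0 < a) : ‖gE1 a u‖ = Real.sqrt 2 / a * |4 * π * u ^ 3 / 3 - u / 2| := by
  rw [gE1, norm_mul, norm_div, Complex.norm_real, Complex.norm_real, Real.norm_eq_abs, Real.norm_eq_abs,
    abs_of_pos ha]
  have : ‖(1 : ℂ) + I‖ = Real.sqrt 2 := by
    rw [Complex.norm_eq_sqrt_sq_add_sq]; norm_num
  rw [this]

/-- `‖E₂‖ ≤ (u²/2 + 2πu⁴)/a²`. [cite: Gabcke1979, Kap. 1 eq. (1.8)] -/
lemma norm_gE2_le (ha : 0 < a) : ‖gE2 a u‖ ≤ (u ^ 2 / 2 + 2 * π * u ^ 4) / a ^ 2 := by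
  rw [gE2, norm_mul, norm_div, Complex.norm_I, norm_pow, Complex.norm_real, Real.norm_eq_abs, abs_of_pos ha,
    Complex.norm_real, Real.norm_eq_abs]
  rw [one_div, ← div_eq_inv_mul]
  refine div_le_div_of_nonneg_right ?_ (by positivity)
  refine abs_le.2 ⟨?_, ?_⟩ <;> nlinarith [sq_nonneg u, sq_nonneg (u ^ 2), Real.pi_pos]

/-- **Bound for Gabcke's exponent** on `|u| ≤ a/2` (`a > 0`): with `‖w‖ = √2|u|/a ≤ 1/√2`,
`‖E‖ ≤ (√2/a)|4πu³/3 − u/2| + (u²/2 + 2πu⁴)/a² + (2 + √2)(√2/a³)(8π|u|⁵/5 + |u|³/3)`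
(the last term from `‖L₄(w)‖ ≤ ‖w‖⁵/(5(1−‖w‖))`, `‖L₂(w)‖ ≤ ‖w‖³/(3(1−‖w‖))`, `1/(1 − 1/√2) = 2 + √2`).
[cite: Gabcke1979, §3.1 Satz 3.1.2] -/
theorem norm_gExp_le (ha : 0 < a) (hu : |u| ≤ a / 2) :
    ‖gExp a u‖ ≤ Real.sqrt 2 / a * |4 * π * u ^ 3 / 3 - u / 2| + (u ^ 2 / 2 + 2 * π * u ^ 4) / a ^ 2
      + (2 + Real.sqrt 2) * (Real.sqrt 2 / a ^ 3 * (8 * π * |u| ^ 5 / 5 + |u| ^ 3 / 3)) := by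
  have ha0 : a ≠ 0 := ha.ne'
  have hs2 : Real.sqrt 2 * Real.sqrt 2 = 2 := Real.mul_self_sqrt (by norm_num)
  have hs1 : 1 < Real.sqrt 2 := by
    rw [show (1 : ℝ) = Real.sqrt 1 by simp]; exact Real.sqrt_lt_sqrt (by norm_num) (by norm_num)
  have hw : ‖gW a u‖ = Real.sqrt 2 * |u| / a := norm_gW ha
  have hw1 : ‖gW a u‖ ≤ Real.sqrt 2 / 2 := by
    rw [hw, div_le_div_iff₀ ha (by norm_num : (0:ℝ) < 2)]
    nlinarith [Real.sqrt_nonneg 2, abs_nonneg u]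
  have hw_lt : ‖gW a u‖ < 1 := by nlinarith [Real.sqrt_nonneg 2]
  -- the two Taylor remainders
  have hL4 := Complex.norm_log_sub_logTaylor_le 4 hw_lt
  have hL2 := Complex.norm_log_sub_logTaylor_le 2 hw_lt
  -- `(1 − ‖w‖)⁻¹ ≤ 2 + √2`
  have hinv : (1 - ‖gW a u‖)⁻¹ ≤ 2 + Real.sqrt 2 := by
    rw [inv_le_comm₀ (by linarith) (by positivity)]
    have : (2 + Real.sqrt 2)⁻¹ = 1 - Real.sqrt 2 / 2 := by
      have h0 : (2 + Real.sqrt 2) ≠ 0 := by positivity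
      field_simp
      nlinarith [hs2]
    rw [this]; linarith
  rw [gExp_eq_add_add ha0]
  refine (norm_add_le _ _).trans (add_le_add ((norm_add_le _ _).trans (add_le_add (le_of_eq (norm_gE1 ha))
    (norm_gE2_le ha))) ?_)
  refine (norm_sub_le _ _).trans ?_
  rw [norm_mul, norm_div, Complex.norm_ofNat, norm_neg]
  have hA : ‖2 * ↑π * I * (a : ℂ) ^ 2‖ = 2 * π * a ^ 2 := by
    rw [norm_mul, norm_mul, norm_mul, Complex.norm_I, norm_pow, Complex.norm_real, Complex.norm_real,
      Complex.norm_ofNat, Real.norm_eq_abs, Real.norm_eq_abs, abs_of_pos Real.pi_pos, abs_of_pos ha]; ring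
  rw [hA]
  -- substitute `‖w‖ = √2|u|/a`
  have hw5 : ‖gW a u‖ ^ 5 = 4 * Real.sqrt 2 * |u| ^ 5 / a ^ 5 := by
    rw [hw, div_pow, mul_pow]
    have : Real.sqrt 2 ^ 5 = 4 * Real.sqrt 2 := by
      rw [show (5:ℕ) = 2 + 2 + 1 by norm_num, pow_add, pow_add, pow_one, Real.sq_sqrt (by norm_num : (0:ℝ) ≤ 2)]
      ring
    rw [this]
  have hw3 : ‖gW a u‖ ^ 3 = 2 * Real.sqrt 2 * |u| ^ 3 / a ^ 3 := by
    rw [hw, div_pow, mul_pow]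
    have : Real.sqrt 2 ^ 3 = 2 * Real.sqrt 2 := by
      rw [show (3:ℕ) = 2 + 1 by norm_num, pow_add, pow_one, Real.sq_sqrt (by norm_num : (0:ℝ) ≤ 2)]
    rw [this]
  norm_num at hL4 hL2
  have h4 : ‖Complex.log (1 + gW a u) - logTaylor 5 (gW a u)‖ ≤ 4 * Real.sqrt 2 * |u| ^ 5 / a ^ 5 * (2 + Real.sqrt 2) / 5 := by
    refine hL4.trans ?_
    rw [hw5]
    gcongr
  have h2 : ‖Complex.log (1 + gW a u) - logTaylor 3 (gW a u)‖ ≤ 2 * Real.sqrt 2 * |u| ^ 3 / a ^ 3 * (2 + Real.sqrt 2) / 3 := by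
    refine hL2.trans ?_
    rw [hw3]
    gcongr
  have hpos1 : 0 ≤ 2 * π * a ^ 2 := by positivity
  calc 2 * π * a ^ 2 * ‖Complex.log (1 + gW a u) - logTaylor 5 (gW a u)‖
        + ‖Complex.log (1 + gW a u) - logTaylor 3 (gW a u)‖ / 2
      ≤ 2 * π * a ^ 2 * (4 * Real.sqrt 2 * |u| ^ 5 / a ^ 5 * (2 + Real.sqrt 2) / 5)
        + (2 * Real.sqrt 2 * |u| ^ 3 / a ^ 3 * (2 + Real.sqrt 2) / 3) / 2 := by gcongr
    _ = (2 + Real.sqrt 2) * (Real.sqrt 2 / a ^ 3 * (8 * π * |u| ^ 5 / 5 + |u| ^ 3 / 3)) := by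
        field_simp; ring

/-! ## The real part of `E` -/

/-- `Re w = Im w = u/a`. [folklore] -/
private lemma gW_re_im (ha : a ≠ 0) : (gW a u).re = u / a ∧ (gW a u).im = u / a := by
  constructor <;> (simp [gW, Complex.div_re, Complex.div_im, Complex.normSq_ofReal]; field_simp)

/-- **Real part of Gabcke's exponent**: `Re E = 2πa²(arg(1+w) − y + y²) − ¼ log(1 + 2y + 2y²)`, `y = u/a`
(`Im log(1+w) = arg(1+w)`, `Re log(1+w) = log ‖1+w‖`, `‖1+w‖² = 1 + 2y + 2y²`). [cite: Gabcke1979, §3.1 Satz 3.1.2] -/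
theorem gExp_re (ha : 0 < a) :
    (gExp a u).re = 2 * π * a ^ 2 * (Complex.arg (1 + gW a u) - u / a + (u / a) ^ 2)
      - Real.log (1 + 2 * (u / a) + 2 * (u / a) ^ 2) / 4 := by
  have ha0 : a ≠ 0 := ha.ne'
  obtain ⟨hwre, hwim⟩ := gW_re_im (u := u) ha0
  have hform : gExp a u = ((2 * π * a ^ 2 : ℝ) : ℂ) * (I * (gW a u - gW a u ^ 2 / 2 - Complex.log (1 + gW a u)))
      - ((1 / 2 : ℝ) : ℂ) * Complex.log (1 + gW a u) := by
    simp only [gExp]; push_cast; ring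
  have hsq : gW a u ^ 2 / 2 = I * (((u / a) ^ 2 : ℝ) : ℂ) := by
    rw [gW_sq ha0]
    have ha' : (a : ℂ) ≠ 0 := Complex.ofReal_ne_zero.2 ha0
    push_cast; field_simp
  have hsq_im : (gW a u ^ 2 / 2).im = (u / a) ^ 2 := by
    rw [hsq, Complex.I_mul_im, Complex.ofReal_re]
  have hlog_re : (Complex.log (1 + gW a u)).re = Real.log (1 + 2 * (u / a) + 2 * (u / a) ^ 2) / 2 := by
    rw [Complex.log_re]
    have hn : ‖1 + gW a u‖ = Real.sqrt (1 + 2 * (u / a) + 2 * (u / a) ^ 2) := by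
      rw [← normSq_one_add_gW ha0, Real.sqrt_sq (norm_nonneg _)]
    rw [hn, Real.log_sqrt]
    nlinarith [sq_nonneg (u / a + 1 / 2)]
  rw [hform, Complex.sub_re, Complex.re_ofReal_mul, Complex.re_ofReal_mul, Complex.I_mul_re, Complex.sub_im,
    Complex.sub_im, hwim, hsq_im, Complex.log_im, hlog_re]
  ring

/-- For `1 + y > 0` the argument of `1 + w = (1+y) + yi` is `arctan(y/(1+y))`. [folklore] -/
private lemma arg_one_add_gW (ha : 0 < a) (hy : -1 < u / a) :
    Complex.arg (1 + gW a u) = Real.arctan ((u / a) / (1 + u / a)) := by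
  have ha0 : a ≠ 0 := ha.ne'
  have hre : 0 < (1 + gW a u).re := by rw [one_add_gW_re ha0]; linarith
  have h1 : |Complex.arg (1 + gW a u)| < π / 2 := Complex.abs_arg_lt_pi_div_two_iff.2 (Or.inl hre)
  have h2 := Real.arctan_tan (abs_lt.1 h1).1 (abs_lt.1 h1).2
  rw [Complex.tan_arg, one_add_gW_re ha0, one_add_gW_im ha0] at h2
  exact h2.symm

/-! ## Three arc-tangent inequalities -/

/-- The derivative of `y ↦ arctan(y/(1+y))` is `1/(1 + 2y + 2y²)` (`y ≠ −1`). [folklore] -/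
private lemma hasDerivAt_arctan_div {y : ℝ} (hy : 1 + y ≠ 0) :
    HasDerivAt (fun y : ℝ ↦ Real.arctan (y / (1 + y))) (1 / (1 + 2 * y + 2 * y ^ 2)) y := by
  have hq : 1 + 2 * y + 2 * y ^ 2 ≠ 0 := by
    have : (0 : ℝ) < (1 + y) ^ 2 + y ^ 2 := by positivity
    nlinarith
  have h1 : HasDerivAt (fun y : ℝ ↦ y / (1 + y)) (1 / (1 + y) ^ 2) y := by
    have h := (hasDerivAt_id' y).div ((hasDerivAt_id' y).const_add 1) hy
    refine h.congr_deriv ?_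
    field_simp
    ring
  refine h1.arctan.congr_deriv ?_
  have e : (1 + (y / (1 + y)) ^ 2) * (1 + y) ^ 2 = 1 + 2 * y + 2 * y ^ 2 := by
    field_simp
    ring
  rw [div_mul_div_comm, one_mul, e]

/-- Monotonicity packaged for the three inequalities below: if `F` has derivative `F'` at every `y > −1` and
`F' ≥ 0` on `(c, d)` (`c > −1`), then `F c ≤ F y` for `c ≤ y ≤ d`. [folklore] -/
private lemma monotone_helper {F F' : ℝ → ℝ} {c d : ℝ} (hc : -1 < c)
    (hF : ∀ y, -1 < y → HasDerivAt F (F' y) y) (hpos : ∀ y, c < y → y < d → 0 ≤ F' y) {y : ℝ} (hy : c ≤ y)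
    (hyd : y ≤ d) : F c ≤ F y := by
  have hcont : ContinuousOn F (Icc c d) := fun x hx ↦
    (hF x (lt_of_lt_of_le hc hx.1)).continuousAt.continuousWithinAt
  have hmono := monotoneOn_of_deriv_nonneg (convex_Icc c d) hcont
    (fun x hx ↦ by
      rw [interior_Icc] at hx
      exact (hF x (hc.trans hx.1)).differentiableAt.differentiableWithinAt)
    (fun x hx ↦ by
      rw [interior_Icc] at hx
      rw [(hF x (hc.trans hx.1)).deriv]; exact hpos x hx.1 hx.2)
  exact hmono ⟨le_rfl, hy.trans hyd⟩ ⟨hy, hyd⟩ hy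

/-- `arctan(y/(1+y)) ≤ y − y² + ⅔ y³` for `y ≥ 0` (the difference has derivative `4y⁴/(1+2y+2y²) ≥ 0`).
[folklore] -/
private lemma arctan_div_le_cubic {y : ℝ} (hy : 0 ≤ y) : Real.arctan (y / (1 + y)) ≤ y - y ^ 2 + 2 / 3 * y ^ 3 := by
  have h := monotone_helper (F := fun y : ℝ ↦ y - y ^ 2 + 2 / 3 * y ^ 3 - Real.arctan (y / (1 + y)))
    (F' := fun y : ℝ ↦ 1 - 2 * y + 2 * y ^ 2 - 1 / (1 + 2 * y + 2 * y ^ 2)) (c := 0) (d := y) (by norm_num)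
    (fun y hy ↦ by
      have hd := hasDerivAt_arctan_div (y := y) (by linarith)
      have hp : HasDerivAt (fun y : ℝ ↦ y - y ^ 2 + 2 / 3 * y ^ 3) (1 - 2 * y + 2 * y ^ 2) y := by
        refine (((hasDerivAt_id' y).sub (hasDerivAt_pow 2 y)).add ((hasDerivAt_pow 3 y).const_mul (2 / 3))).congr_deriv ?_
        push_cast; ring
      exact hp.sub hd)
    (fun y hy _ ↦ by
      have hq : 0 < 1 + 2 * y + 2 * y ^ 2 := by nlinarith
      rw [sub_nonneg, div_le_iff₀ hq]; nlinarith [sq_nonneg y, sq_nonneg (y ^ 2)])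
    hy le_rfl
  have h' : (0 : ℝ) - 0 ^ 2 + 2 / 3 * 0 ^ 3 - Real.arctan (0 / (1 + 0))
      ≤ y - y ^ 2 + 2 / 3 * y ^ 3 - Real.arctan (y / (1 + y)) := h
  rw [zero_div, Real.arctan_zero] at h'
  linarith

/-- `arctan(y/(1+y)) ≤ y − y²` for `−½ ≤ y ≤ 0` (the difference has derivative `−2y²(1+2y)/(1+2y+2y²) ≤ 0`
there, and vanishes at `0`). [folklore] -/
private lemma arctan_div_le_quad {y : ℝ} (hy1 : -1 / 2 ≤ y) (hy2 : y ≤ 0) : Real.arctan (y / (1 + y)) ≤ y - y ^ 2 := by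
  have h := monotone_helper (F := fun y : ℝ ↦ -(y - y ^ 2 - Real.arctan (y / (1 + y))))
    (F' := fun y : ℝ ↦ -(1 - 2 * y - 1 / (1 + 2 * y + 2 * y ^ 2))) (c := y) (d := 0) (by linarith)
    (fun x hx ↦ by
      have hd := hasDerivAt_arctan_div (y := x) (by linarith)
      have hp : HasDerivAt (fun y : ℝ ↦ y - y ^ 2) (1 - 2 * x) x := by
        refine ((hasDerivAt_id' x).sub (hasDerivAt_pow 2 x)).congr_deriv ?_
        push_cast; ring
      exact (hp.sub hd).neg)
    (fun x hx hx0 ↦ by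
      have hq : 0 < 1 + 2 * x + 2 * x ^ 2 := by nlinarith
      have : 1 - 2 * x - 1 / (1 + 2 * x + 2 * x ^ 2) ≤ 0 := by
        rw [sub_nonpos, le_div_iff₀ hq]; nlinarith [sq_nonneg x]
      linarith)
    (y := 0) hy2 le_rfl
  have h' : -(y - y ^ 2 - Real.arctan (y / (1 + y))) ≤ -((0 : ℝ) - 0 ^ 2 - Real.arctan (0 / (1 + 0))) := h
  rw [zero_div, Real.arctan_zero] at h'
  linarith

/-- `arctan(y/(1+y)) ≤ y + y²/2` for `y > −1` (the difference is antitone on `(−1, 0]` and monotone on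
`[0, ∞)`, vanishing at `0`). [folklore] -/
private lemma arctan_div_le_lin {y : ℝ} (hy : -1 < y) : Real.arctan (y / (1 + y)) ≤ y + y ^ 2 / 2 := by
  have hderiv : ∀ x : ℝ, -1 < x →
      HasDerivAt (fun y : ℝ ↦ y + y ^ 2 / 2 - Real.arctan (y / (1 + y))) (1 + x - 1 / (1 + 2 * x + 2 * x ^ 2)) x := by
    intro x hx
    have hd := hasDerivAt_arctan_div (y := x) (by linarith)
    have hp : HasDerivAt (fun y : ℝ ↦ y + y ^ 2 / 2) (1 + x) x := by
      refine ((hasDerivAt_id' x).add ((hasDerivAt_pow 2 x).div_const 2)).congr_deriv ?_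
      push_cast; ring
    exact hp.sub hd
  rcases le_or_gt 0 y with h0 | h0
  · have h := monotone_helper (F := fun y : ℝ ↦ y + y ^ 2 / 2 - Real.arctan (y / (1 + y)))
      (F' := fun y : ℝ ↦ 1 + y - 1 / (1 + 2 * y + 2 * y ^ 2)) (c := 0) (d := y) (by norm_num) hderiv
      (fun x hx _ ↦ by
        have hq : 0 < 1 + 2 * x + 2 * x ^ 2 := by nlinarith
        rw [sub_nonneg, div_le_iff₀ hq]; nlinarith [sq_nonneg x])
      h0 le_rfl
    have h' : (0 : ℝ) + 0 ^ 2 / 2 - Real.arctan (0 / (1 + 0)) ≤ y + y ^ 2 / 2 - Real.arctan (y / (1 + y)) := h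
    rw [zero_div, Real.arctan_zero] at h'
    linarith
  · have h := monotone_helper (F := fun y : ℝ ↦ -(y + y ^ 2 / 2 - Real.arctan (y / (1 + y))))
      (F' := fun y : ℝ ↦ -(1 + y - 1 / (1 + 2 * y + 2 * y ^ 2))) (c := y)
      (d := 0) hy (fun x hx ↦ (hderiv x hx).neg)
      (fun x hx hx0 ↦ by
        have hq : 0 < 1 + 2 * x + 2 * x ^ 2 := by nlinarith
        have : 1 + x - 1 / (1 + 2 * x + 2 * x ^ 2) ≤ 0 := by
          rw [sub_nonpos, le_div_iff₀ hq]; nlinarith [sq_nonneg x]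
        linarith)
      (y := 0) h0.le le_rfl
    have h' : -(y + y ^ 2 / 2 - Real.arctan (y / (1 + y))) ≤ -((0 : ℝ) + 0 ^ 2 / 2 - Real.arctan (0 / (1 + 0))) := h
    rw [zero_div, Real.arctan_zero] at h'
    linarith

/-! ## Consequences for `Re E` in the three regimes -/

/-- `arg(1 + w) ≤ y + y²/2` for every real `u` (`y = u/a`): by `arctan_div_le_lin` when `1 + y > 0`, and because
the argument is `≤ −π/2 < −1/2 ≤ y + y²/2` when `1 + y ≤ 0`. [folklore] -/
private lemma arg_one_add_gW_le (ha : 0 < a) : Complex.arg (1 + gW a u) ≤ u / a + (u / a) ^ 2 / 2 := by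
  have ha0 : a ≠ 0 := ha.ne'
  set y : ℝ := u / a with hy
  rcases lt_or_ge (-1 : ℝ) y with h1 | h1
  · rw [arg_one_add_gW ha h1]; exact arctan_div_le_lin h1
  · -- `1 + y ≤ 0`: the point `(1+y) + yi` lies in the closed lower-left quadrant, so `arg ≤ −π/2`
    have hre : (1 + gW a u).re = 1 + y := one_add_gW_re ha0
    have him : (1 + gW a u).im = y := one_add_gW_im ha0
    have harg : Complex.arg (1 + gW a u) ≤ -(π / 2) := by
      rcases eq_or_lt_of_le (show 1 + y ≤ 0 by linarith) with h0 | h0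
      · -- `re = 0`, `im = y = −1`
        have hy1 : y = -1 := by linarith
        rw [Complex.arg_of_re_nonneg (by rw [hre, h0]), him]
        have hn : ‖1 + gW a u‖ = 1 := by
          have := normSq_one_add_gW (u := u) ha0
          rw [← hy, hy1] at this
          norm_num at this
          rcases this with h | h
          · exact h
          · linarith [norm_nonneg (1 + gW a u)]
        rw [hn, hy1, div_one, Real.arcsin_neg_one]
      · rw [Complex.arg_of_re_neg_of_im_neg (by rw [hre]; exact h0) (by rw [him]; linarith)]
        linarith [Real.arcsin_le_pi_div_two ((-(1 + gW a u)).im / ‖1 + gW a u‖)]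
    have : -(π / 2) ≤ -1 / 2 - 1 := by linarith [Real.pi_gt_three]
    nlinarith [sq_nonneg (y + 1)]

/-- **Regime `u ≥ 0`**: `Re E(a,u) ≤ (4π/3) u³/a` (from `arctan(y/(1+y)) ≤ y − y² + ⅔y³` and `‖1+w‖ ≥ 1`).
[cite: Gabcke1979, §3.1 Satz 3.1.2] -/
theorem gExp_re_le_of_nonneg (ha : 0 < a) (hu : 0 ≤ u) : (gExp a u).re ≤ 4 * π / 3 * u ^ 3 / a := by
  have ha0 : a ≠ 0 := ha.ne'
  have hy : 0 ≤ u / a := div_nonneg hu ha.le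
  rw [gExp_re ha, arg_one_add_gW ha (by linarith)]
  have h1 := arctan_div_le_cubic hy
  have hlog : 0 ≤ Real.log (1 + 2 * (u / a) + 2 * (u / a) ^ 2) := Real.log_nonneg (by nlinarith)
  have h2 : 2 * π * a ^ 2 * (Real.arctan (u / a / (1 + u / a)) - u / a + (u / a) ^ 2)
      ≤ 2 * π * a ^ 2 * (2 / 3 * (u / a) ^ 3) :=
    mul_le_mul_of_nonneg_left (by linarith) (by positivity)
  have h3 : 2 * π * a ^ 2 * (2 / 3 * (u / a) ^ 3) = 4 * π / 3 * u ^ 3 / a := by field_simp; ring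
  linarith

/-- **Regime `−a/2 ≤ u ≤ 0`**: `e^{Re E(a,u)} ≤ 1 + |u|/a` (from `arctan(y/(1+y)) ≤ y − y²`,
`‖1+w‖ ≥ 1 + y` and `(1+y)^{−1/2} ≤ 1 − y` on `[−½, 0]`). [cite: Gabcke1979, §3.1 Satz 3.1.2] -/
theorem exp_gExp_re_le_of_nonpos (ha : 0 < a) (hu1 : -(a / 2) ≤ u) (hu2 : u ≤ 0) :
    Real.exp ((gExp a u).re) ≤ 1 + |u| / a := by
  have ha0 : a ≠ 0 := ha.ne'
  set y : ℝ := u / a with hy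
  have hy1 : -1 / 2 ≤ y := by rw [hy, le_div_iff₀ ha]; linarith
  have hy2 : y ≤ 0 := div_nonpos_of_nonpos_of_nonneg hu2 ha.le
  have habs : |u| / a = -y := by rw [abs_of_nonpos hu2, hy, neg_div]
  rw [habs, gExp_re ha, arg_one_add_gW ha (by linarith), ← hy]
  have h1 := arctan_div_le_quad hy1 hy2
  have hA : 2 * π * a ^ 2 * (Real.arctan (y / (1 + y)) - y + y ^ 2) ≤ 0 :=
    mul_nonpos_of_nonneg_of_nonpos (by positivity) (by linarith)
  -- `−¼ log(1+2y+2y²) ≤ −½ log(1+y)` since `1 + 2y + 2y² ≥ (1+y)² > 0`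
  have hpos : 0 < 1 + y := by linarith
  have hlog : -(Real.log (1 + 2 * y + 2 * y ^ 2) / 4) ≤ -(Real.log (1 + y) / 2) := by
    have : Real.log ((1 + y) ^ 2) ≤ Real.log (1 + 2 * y + 2 * y ^ 2) :=
      Real.log_le_log (by positivity) (by nlinarith [sq_nonneg y])
    rw [Real.log_pow] at this
    push_cast at this
    linarith
  have hB : Real.exp (2 * π * a ^ 2 * (Real.arctan (y / (1 + y)) - y + y ^ 2)
      - Real.log (1 + 2 * y + 2 * y ^ 2) / 4) ≤ Real.exp (-(Real.log (1 + y) / 2)) :=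
    Real.exp_le_exp.2 (by linarith)
  refine hB.trans ?_
  -- `e^{−½ log(1+y)} = (√(1+y))⁻¹ ≤ 1 − y`
  have hsq : Real.exp (-(Real.log (1 + y) / 2)) = (Real.sqrt (1 + y))⁻¹ := by
    rw [Real.sqrt_eq_rpow, Real.rpow_def_of_pos hpos, ← Real.exp_neg]
    congr 1; ring
  rw [hsq, inv_le_comm₀ (Real.sqrt_pos.2 hpos) (by linarith)]
  -- now `(1 − y)⁻¹ ≤ √(1+y)`, i.e. `1 ≤ (1+y)(1−y)²` on `[−1/2, 0]`
  rw [show (1 + -y)⁻¹ = Real.sqrt ((1 / (1 - y)) ^ 2) by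
    rw [Real.sqrt_sq (div_pos one_pos (by linarith)).le]; ring]
  refine Real.sqrt_le_sqrt ?_
  rw [div_pow, one_pow, div_le_iff₀ (pow_pos (by linarith) 2)]
  nlinarith [mul_nonneg (neg_nonneg.2 hy2) (show 0 ≤ 1 + y - y ^ 2 by nlinarith)]

/-- **Far regime (all `u`)**: `−4πu² + Re E(a,u) ≤ −πu² + (log 2)/4` (from `arg(1+w) ≤ y + y²/2` and
`‖1+w‖² ≥ 1/2`); i.e. `e^{−4πu²} |g̃(a,u)| ≤ 2^{1/4} e^{−πu²}`. [cite: Gabcke1979, §3.1 Satz 3.1.2] -/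
theorem gExp_re_le_far (ha : 0 < a) : -4 * π * u ^ 2 + (gExp a u).re ≤ -π * u ^ 2 + Real.log 2 / 4 := by
  have ha0 : a ≠ 0 := ha.ne'
  rw [gExp_re ha]
  have h1 := arg_one_add_gW_le (u := u) ha
  have hA : 2 * π * a ^ 2 * (Complex.arg (1 + gW a u) - u / a + (u / a) ^ 2)
      ≤ 2 * π * a ^ 2 * (3 / 2 * (u / a) ^ 2) :=
    mul_le_mul_of_nonneg_left (by linarith) (by positivity)
  have hA' : 2 * π * a ^ 2 * (3 / 2 * (u / a) ^ 2) = 3 * π * u ^ 2 := by field_simp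
  have hlog : -Real.log 2 ≤ Real.log (1 + 2 * (u / a) + 2 * (u / a) ^ 2) := by
    rw [← Real.log_inv]
    exact Real.log_le_log (by norm_num) (by nlinarith [sq_nonneg (u / a + 1 / 2)])
  linarith

/-! ## `‖e^E − 1‖ ≤ ‖E‖ max(1, e^{Re E})` -/

/-- For every complex `E`: `‖e^E − 1‖ ≤ ‖E‖ · max(1, e^{Re E})` (`e^E − 1 = ∫₀¹ E e^{sE} ds` and
`|e^{sE}| = e^{s Re E} ≤ max(1, e^{Re E})` for `0 ≤ s ≤ 1`). [folklore] -/
private theorem norm_cexp_sub_one_le (E : ℂ) : ‖cexp E - 1‖ ≤ ‖E‖ * max 1 (Real.exp E.re) := by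
  have hderiv : ∀ s ∈ Set.uIcc (0 : ℝ) 1,
      HasDerivAt (fun s : ℝ ↦ cexp ((s : ℂ) * E)) (cexp ((s : ℂ) * E) * E) s := by
    intro s _
    have h1 : HasDerivAt (fun s : ℝ ↦ (s : ℂ) * E) E s := by
      simpa using ((hasDerivAt_id' s).ofReal_comp).mul_const E
    exact h1.cexp
  have hcont : Continuous fun s : ℝ ↦ cexp ((s : ℂ) * E) * E := by fun_prop
  have hint := intervalIntegral.integral_eq_sub_of_hasDerivAt hderiv (hcont.intervalIntegrable 0 1)
  simp only [Complex.ofReal_one, one_mul, Complex.ofReal_zero, zero_mul, Complex.exp_zero] at hint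
  rw [← hint]
  have hb := intervalIntegral.norm_integral_le_of_norm_le_const (a := (0:ℝ)) (b := 1)
    (f := fun s : ℝ ↦ cexp ((s : ℂ) * E) * E) (C := ‖E‖ * max 1 (Real.exp E.re)) (fun s hs ↦ ?_)
  · simpa using hb
  · rw [Set.uIoc_of_le zero_le_one] at hs
    rw [norm_mul, Complex.norm_exp, mul_comm]
    refine mul_le_mul_of_nonneg_left ?_ (norm_nonneg _)
    have hsre : ((s : ℂ) * E).re = s * E.re := by simp [Complex.mul_re]
    rw [hsre]
    rcases le_or_gt 0 E.re with h0 | h0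
    · exact (Real.exp_le_exp.2 (by nlinarith [hs.2])).trans (le_max_right _ _)
    · exact (Real.exp_le_one_iff.2 (by nlinarith [hs.1.le])).trans (le_max_left _ _)

/-! ## The pointwise majorants of `e^{−4πu²} |g̃ − 1|` -/

/-- The majorant of `‖E(a,u)‖` on `|u| ≤ a/2` as a real function:
`B(a,u) = (√2/a)|4πu³/3 − u/2| + (u²/2 + 2πu⁴)/a² + (2+√2)(√2/a³)(8π|u|⁵/5 + |u|³/3)`.
[cite: Gabcke1979, §3.1 Satz 3.1.2] -/
def gBound (a u : ℝ) : ℝ :=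
  Real.sqrt 2 / a * |4 * π * u ^ 3 / 3 - u / 2| + (u ^ 2 / 2 + 2 * π * u ^ 4) / a ^ 2
    + (2 + Real.sqrt 2) * (Real.sqrt 2 / a ^ 3 * (8 * π * |u| ^ 5 / 5 + |u| ^ 3 / 3))

/-- `B(a,u) ≥ 0`. [cite: Gabcke1979, §3.1 Satz 3.1.2] -/
lemma gBound_nonneg (ha : 0 < a) : 0 ≤ gBound a u := by
  unfold gBound; positivity

/-- **Majorant for `u ∈ [0, a/2]`**: `e^{−4πu²} ‖g̃(a,u) − 1‖ ≤ B(a,u) e^{−(10π/3)u²}`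
(`max(1, e^{Re E}) ≤ e^{(2π/3)u²}` since `Re E ≤ (4π/3)u³/a ≤ (2π/3)u²`). [cite: Gabcke1979, §3.1 Satz 3.1.2] -/
theorem norm_gTilde_sub_one_le_of_nonneg (ha : 0 < a) (hu0 : 0 ≤ u) (hu : u ≤ a / 2) :
    Real.exp (-4 * π * u ^ 2) * ‖gTilde a u - 1‖ ≤ gBound a u * Real.exp (-(10 * π / 3) * u ^ 2) := by
  have h1 := norm_cexp_sub_one_le (gExp a u)
  have h2 := norm_gExp_le ha (show |u| ≤ a / 2 by rwa [abs_of_nonneg hu0])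
  have h3 : max 1 (Real.exp (gExp a u).re) ≤ Real.exp (2 * π / 3 * u ^ 2) := by
    refine max_le (Real.one_le_exp (by positivity)) (Real.exp_le_exp.2 ?_)
    refine (gExp_re_le_of_nonneg ha hu0).trans ?_
    rw [div_le_iff₀ ha]
    have : u ^ 3 ≤ u ^ 2 * (a / 2) := by nlinarith [sq_nonneg u]
    nlinarith [Real.pi_pos]
  rw [gTilde]
  calc Real.exp (-4 * π * u ^ 2) * ‖cexp (gExp a u) - 1‖
      ≤ Real.exp (-4 * π * u ^ 2) * (gBound a u * Real.exp (2 * π / 3 * u ^ 2)) := by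
        refine mul_le_mul_of_nonneg_left (h1.trans ?_) (Real.exp_pos _).le
        exact mul_le_mul h2 h3 (le_trans zero_le_one (le_max_left _ _)) (gBound_nonneg ha)
    _ = gBound a u * Real.exp (-(10 * π / 3) * u ^ 2) := by
        rw [mul_left_comm, ← Real.exp_add]; congr 2; ring

/-- **Majorant for `u ∈ [−a/2, 0]`**: `e^{−4πu²} ‖g̃(a,u) − 1‖ ≤ B(a,u) (1 + |u|/a) e^{−4πu²}`.
[cite: Gabcke1979, §3.1 Satz 3.1.2] -/
theorem norm_gTilde_sub_one_le_of_nonpos (ha : 0 < a) (hu1 : -(a / 2) ≤ u) (hu2 : u ≤ 0) :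
    Real.exp (-4 * π * u ^ 2) * ‖gTilde a u - 1‖ ≤ gBound a u * (1 + |u| / a) * Real.exp (-4 * π * u ^ 2) := by
  have h1 := norm_cexp_sub_one_le (gExp a u)
  have h2 := norm_gExp_le ha (show |u| ≤ a / 2 by rw [abs_of_nonpos hu2]; linarith)
  have h3 : max 1 (Real.exp (gExp a u).re) ≤ 1 + |u| / a :=
    max_le (by have := div_nonneg (abs_nonneg u) ha.le; linarith) (exp_gExp_re_le_of_nonpos ha hu1 hu2)
  rw [gTilde, mul_comm]
  refine mul_le_mul_of_nonneg_right (h1.trans ?_) (Real.exp_pos _).le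
  exact mul_le_mul h2 h3 (le_trans zero_le_one (le_max_left _ _)) (gBound_nonneg ha)

/-- **Majorant for all `u`** (used for `|u| > a/2`): `e^{−4πu²} ‖g̃(a,u) − 1‖ ≤ e^{(log 2)/4} e^{−πu²} + e^{−4πu²}`.
[cite: Gabcke1979, §3.1 Satz 3.1.2] -/
theorem norm_gTilde_sub_one_le_far (ha : 0 < a) :
    Real.exp (-4 * π * u ^ 2) * ‖gTilde a u - 1‖
      ≤ Real.exp (Real.log 2 / 4) * Real.exp (-π * u ^ 2) + Real.exp (-4 * π * u ^ 2) := by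
  have h1 : ‖gTilde a u - 1‖ ≤ Real.exp (gExp a u).re + 1 := by
    refine (norm_sub_le _ _).trans ?_
    rw [gTilde, Complex.norm_exp, norm_one]
  have h2 := gExp_re_le_far (u := u) ha
  calc Real.exp (-4 * π * u ^ 2) * ‖gTilde a u - 1‖
      ≤ Real.exp (-4 * π * u ^ 2) * (Real.exp (gExp a u).re + 1) :=
        mul_le_mul_of_nonneg_left h1 (Real.exp_pos _).le
    _ = Real.exp (-4 * π * u ^ 2 + (gExp a u).re) + Real.exp (-4 * π * u ^ 2) := by rw [Real.exp_add]; ring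
    _ ≤ Real.exp (-π * u ^ 2 + Real.log 2 / 4) + Real.exp (-4 * π * u ^ 2) := by
        gcongr
    _ = Real.exp (Real.log 2 / 4) * Real.exp (-π * u ^ 2) + Real.exp (-4 * π * u ^ 2) := by
        rw [Real.exp_add, mul_comm]

end Gabcke

end Literature.NumberTheory.LFunctions
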